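import Mathlib
import Literature.Computability.AlgebraicComplexity.OrbitClosure
import Literature.Computability.AlgebraicComplexity.StandardFamiliesProofs

/-!
# Partial derivatives of the padded permanent and the substitution `ℓ ↦ 1`, `z ↦ 0`

Topic `Literature/Computability/AlgebraicComplexity`.  Elementary bookkeeping for the padded
permanent `pp = paddedPerPoly ℂ n m = ℓ ^ p · P` of Mulmuley–Sohoni (`ℓ = X (0,0)`,
`p = m - n`, `P = rename ι (perPoly (BlockIdx n m) ℂ)` the permanent of the bottom-right block,
`ι` the block embedding), as needed for the Lie-algebra stabiliser computations of geometric
complexity theory (Landsberg 2017, §6.6; the stabiliser of `ℓ^{m-n} per_n` in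
Landsberg–Manivel–Ressayre 2013, §6):

* generalities: a renamed polynomial is killed by `∂_z` for `z` outside the range of the
  renaming (`pderiv_rename_eq_zero_of_forall_ne`); separation of an identity `A + B + C = D` into
  its homogeneous components of degrees `d`, `d - 1`, `d + 1` (`isHomogeneous_separate_three`);
* the partials of `pp`: `∂_z pp = 0` off the block and away from `ℓ`
  (`pderiv_paddedPerPoly_nonspecial`), `∂_{ι a} pp = ℓ ^ p · rename ι (∂_a per_B)`
  (`pderiv_paddedPerPoly_block`), `∂_ℓ pp = p · ℓ ^ {p-1} · P` for `p ≥ 1`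
  (`pderiv_paddedPerPoly_zero`);
* splitting a sum over all `m²` variables into `ℓ`, the block, and the rest
  (`paddedPerPoly_sum_special`);
* the substitution `φ` (`ℓ ↦ 1`, block variables to themselves, the rest `↦ 0`;
  `paddedPerPoly_exists_subst`) and its effect on `pp` and its partials
  (`aeval_subst_paddedPerPoly`, `aeval_subst_pderiv_paddedPerPoly_block`,
  `aeval_subst_pderiv_paddedPerPoly_zero`);
* the image under `φ` of a Lie relation `∑_{a,b} N_{ba} X_b ∂_a pp = c · pp`, sorted by degree
  (`paddedPerPoly_lieRel_subst_zero` for `p = 0`, `paddedPerPoly_lieRel_subst_pos` and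
  `paddedPerPoly_lieRel_row` for `p ≥ 1`).

No new definitions (and no notation): the block embedding is written out as the renaming map
inside `paddedPerPoly`, and the substitution is produced by an existential lemma.

## References

* K. D. Mulmuley, M. Sohoni, *Geometric complexity theory I*, SIAM J. Comput. 31 (2001), §4
  (the padded permanent `ℓ^{m-n} per_n`).
* J. M. Landsberg, L. Manivel, N. Ressayre, *Hypersurfaces with degenerate duals and the geometric
  complexity theory program*, Comment. Math. Helv. 88 (2013), §6 (stabiliser of the padded
  permanent).
* J. M. Landsberg, *Geometry and Complexity Theory*, Cambridge Univ. Press 2017, §6.6.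
-/

open MvPolynomial
open scoped BigOperators

namespace Literature.Computability.AlgebraicComplexity

/-! ## Generalities on partial derivatives and homogeneous components -/

/-- A renamed polynomial is killed by the partial derivatives in the variables outside the range
of the renaming. [folklore] -/
theorem pderiv_rename_eq_zero_of_forall_ne {σ τ R : Type*} [CommSemiring R] {f : σ → τ}
    {z : τ} (hz : ∀ s, f s ≠ z) (Q : MvPolynomial σ R) : pderiv z (rename f Q) = 0 := by
  induction Q using MvPolynomial.induction_on with
  | C a => simp
  | add p q hp hq => simp [hp, hq]
  | mul_X p s hp => simp [hp, pderiv_X_of_ne (hz s)]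

/-- Scalar multiples of homogeneous polynomials are homogeneous (of the same degree). [folklore] -/
theorem isHomogeneous_const_smul {σ R : Type*} [CommSemiring R] {φ : MvPolynomial σ R} {d : ℕ}
    (hφ : φ.IsHomogeneous d) (r : R) : (r • φ).IsHomogeneous d :=
  (homogeneousSubmodule σ R d).smul_mem r hφ

/-- **Degree separation.** If `A + B + C = D` with `A`, `D` homogeneous of degree `d ≥ 1`, `B` of
degree `d - 1` and `C` of degree `d + 1`, then `A = D`, `B = 0` and `C = 0` (compare homogeneous
components). [folklore] -/
theorem isHomogeneous_separate_three {σ R : Type*} [CommSemiring R] {d : ℕ} (hd : 0 < d)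
    {A B C D : MvPolynomial σ R} (hA : A.IsHomogeneous d) (hB : B.IsHomogeneous (d - 1))
    (hC : C.IsHomogeneous (d + 1)) (hD : D.IsHomogeneous d) (h : A + B + C = D) :
    A = D ∧ B = 0 ∧ C = 0 := by
  have key : ∀ k : ℕ, (if k = d then A else 0) + (if k = d - 1 then B else 0) +
      (if k = d + 1 then C else 0) = if k = d then D else 0 := fun k => by
    have hk := congr_arg (homogeneousComponent k) h
    rwa [map_add, map_add, homogeneousComponent_of_mem hA, homogeneousComponent_of_mem hB,
      homogeneousComponent_of_mem hC, homogeneousComponent_of_mem hD] at hk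
  have h1 := key d
  have h2 := key (d - 1)
  have h3 := key (d + 1)
  have hne1 : d ≠ d - 1 := by omega
  have hne2 : d ≠ d + 1 := by omega
  have hne3 : d - 1 ≠ d + 1 := by omega
  simp only [hne1, hne2, hne1.symm, hne2.symm, hne3, hne3.symm, if_true, if_false, add_zero,
    zero_add] at h1 h2 h3
  exact ⟨h1, h2, h3⟩

/-! ## The padded permanent: block embedding and partial derivatives -/

variable (n m : ℕ) [NeZero m]

omit [NeZero m] in
/-- The block embedding is injective. [folklore] -/
theorem paddedPerPoly_blockEmb_injective :
    Function.Injective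
      (fun ij : BlockIdx n m × BlockIdx n m => ((ij.1 : Fin m), (ij.2 : Fin m))) := by
  intro a b h
  simp only [Prod.mk.injEq] at h
  exact Prod.ext (Subtype.ext h.1) (Subtype.ext h.2)

/-- For `p = m - n ≥ 1` the padding variable `(0,0)` is not a block variable. [folklore] -/
theorem paddedPerPoly_not_block_zero (hp : 0 < m - n) :
    ¬ (m - n ≤ (((0, 0) : Fin m × Fin m).1 : ℕ) ∧
        m - n ≤ (((0, 0) : Fin m × Fin m).2 : ℕ)) := by
  simp only [Fin.val_zero, Nat.le_zero, and_self]
  omega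

/-- For `p ≥ 1` no block variable is the padding variable. [folklore] -/
theorem paddedPerPoly_blockEmb_ne_zero (hp : 0 < m - n) (a : BlockIdx n m × BlockIdx n m) :
    ((a.1 : Fin m), (a.2 : Fin m)) ≠ (0, 0) := by
  intro h
  apply paddedPerPoly_not_block_zero n m hp
  rw [← h]
  exact ⟨a.1.2, a.2.2⟩

/-- **Splitting a sum over the variables** into the padding variable (absent for `p = 0`, when it
is a block variable), the block variables, and the rest, on which the summand is assumed to
vanish. [folklore] -/
theorem paddedPerPoly_sum_special {V : Type*} [AddCommMonoid V] (f : Fin m × Fin m → V)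
    (hf : ∀ z : Fin m × Fin m,
      ¬ (m - n ≤ (z.1 : ℕ) ∧ m - n ≤ (z.2 : ℕ)) → z ≠ (0, 0) → f z = 0) :
    ∑ a, f a = (if m - n = 0 then 0 else f (0, 0)) +
      ∑ a : BlockIdx n m × BlockIdx n m, f ((a.1 : Fin m), (a.2 : Fin m)) := by
  have hι := paddedPerPoly_blockEmb_injective n m
  set S : Finset (Fin m × Fin m) := Finset.univ.image
    (fun ij : BlockIdx n m × BlockIdx n m => ((ij.1 : Fin m), (ij.2 : Fin m))) with hSdef
  have hS : ∑ a ∈ S, f a =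
      ∑ a : BlockIdx n m × BlockIdx n m, f ((a.1 : Fin m), (a.2 : Fin m)) :=
    Finset.sum_image fun x _ y _ h => hι h
  have hsub : ∑ a ∈ insert (0, 0) S, f a = ∑ a, f a := by
    apply Finset.sum_subset (Finset.subset_univ _)
    intro z _ hz
    rw [Finset.mem_insert, not_or] at hz
    refine hf z (fun hblk => hz.2 ?_) hz.1
    exact Finset.mem_image.2 ⟨(⟨z.1, hblk.1⟩, ⟨z.2, hblk.2⟩), Finset.mem_univ _, rfl⟩
  rw [← hsub]
  by_cases hp : m - n = 0
  · rw [if_pos hp, zero_add, Finset.insert_eq_of_mem, hS]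
    exact Finset.mem_image.2
      ⟨(⟨0, by simp [hp]⟩, ⟨0, by simp [hp]⟩), Finset.mem_univ _, rfl⟩
  · rw [if_neg hp, Finset.sum_insert, hS]
    intro hmem
    obtain ⟨a, -, ha⟩ := Finset.mem_image.1 hmem
    exact paddedPerPoly_blockEmb_ne_zero n m (Nat.pos_of_ne_zero hp) a ha

/-- Off the block and away from `ℓ = X (0,0)`, the partials of the padded permanent vanish.
[folklore] -/
theorem pderiv_paddedPerPoly_nonspecial {z : Fin m × Fin m}
    (hz : ¬ (m - n ≤ (z.1 : ℕ) ∧ m - n ≤ (z.2 : ℕ))) (hz0 : z ≠ (0, 0)) :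
    pderiv z (paddedPerPoly ℂ n m) = 0 := by
  rw [paddedPerPoly, pderiv_mul, pderiv_pow, pderiv_X_of_ne hz0.symm, mul_zero, zero_mul,
    zero_add, pderiv_rename_eq_zero_of_forall_ne, mul_zero]
  rintro a rfl
  exact hz ⟨a.1.2, a.2.2⟩

/-- The partial of the padded permanent in a block variable:
`∂_{ι a} (ℓ ^ p · rename ι per_B) = ℓ ^ p · rename ι (∂_a per_B)`. [folklore] -/
theorem pderiv_paddedPerPoly_block (a : BlockIdx n m × BlockIdx n m) :
    pderiv ((a.1 : Fin m), (a.2 : Fin m)) (paddedPerPoly ℂ n m) =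
      X (0, 0) ^ (m - n) *
        rename (fun ij : BlockIdx n m × BlockIdx n m => ((ij.1 : Fin m), (ij.2 : Fin m)))
          (pderiv a (perPoly (BlockIdx n m) ℂ)) := by
  rw [paddedPerPoly, pderiv_mul, ← pderiv_rename (paddedPerPoly_blockEmb_injective n m),
    pderiv_pow]
  rcases Nat.eq_zero_or_pos (m - n) with h0 | hp
  · have hc : ((m - n : ℕ) : MvPolynomial (Fin m × Fin m) ℂ) = 0 := by rw [h0, Nat.cast_zero]
    simp only [hc, zero_mul, zero_add]
  · rw [pderiv_X_of_ne (paddedPerPoly_blockEmb_ne_zero n m hp a).symm, mul_zero, zero_mul,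
      zero_add]

/-- The partial of the padded permanent in the padding variable (`p ≥ 1`):
`∂_ℓ (ℓ ^ p · P) = p · ℓ ^ {p-1} · P`. [folklore] -/
theorem pderiv_paddedPerPoly_zero (hp : 0 < m - n) :
    pderiv (0, 0) (paddedPerPoly ℂ n m) = ((m - n : ℕ) : ℂ) •
      (X (0, 0) ^ (m - n - 1) *
        rename (fun ij : BlockIdx n m × BlockIdx n m => ((ij.1 : Fin m), (ij.2 : Fin m)))
          (perPoly (BlockIdx n m) ℂ)) := by
  rw [paddedPerPoly, pderiv_mul,
    pderiv_rename_eq_zero_of_forall_ne (fun a => paddedPerPoly_blockEmb_ne_zero n m hp a),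
    mul_zero, add_zero, pderiv_pow, pderiv_X_self, mul_one, smul_eq_C_mul, C_eq_coe_nat,
    mul_assoc]

/-! ## The substitution `φ`: `ℓ ↦ 1`, block variables to themselves, the rest `↦ 0` -/

/-- **The substitution `φ`** exists: `ℓ = X (0,0) ↦ 1` (if `p ≥ 1`), block variable
`ι b ↦ X b`, every other variable `↦ 0`. [folklore] -/
theorem paddedPerPoly_exists_subst :
    ∃ g : Fin m × Fin m → MvPolynomial (BlockIdx n m × BlockIdx n m) ℂ,
      (∀ b : BlockIdx n m × BlockIdx n m, g ((b.1 : Fin m), (b.2 : Fin m)) = X b) ∧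
      (0 < m - n → g (0, 0) = 1) ∧
      (∀ z : Fin m × Fin m,
        ¬ (m - n ≤ (z.1 : ℕ) ∧ m - n ≤ (z.2 : ℕ)) → z ≠ (0, 0) → g z = 0) := by
  refine ⟨fun v => if h : m - n ≤ (v.1 : ℕ) ∧ m - n ≤ (v.2 : ℕ) then
      X ((⟨v.1, h.1⟩ : BlockIdx n m), (⟨v.2, h.2⟩ : BlockIdx n m))
    else if v = (0, 0) then 1 else 0, fun b => ?_, fun hp => ?_, fun z hz hz0 => ?_⟩
  · obtain ⟨i, j⟩ := b
    simp only [dif_pos (And.intro i.2 j.2), Subtype.coe_eta]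
  · simp only [dif_neg (paddedPerPoly_not_block_zero n m hp), if_true]
  · simp only [dif_neg hz, if_neg hz0]

section Subst

variable {n m}
variable {g : Fin m × Fin m → MvPolynomial (BlockIdx n m × BlockIdx n m) ℂ}
  (hgb : ∀ b : BlockIdx n m × BlockIdx n m, g ((b.1 : Fin m), (b.2 : Fin m)) = X b)
  (hg0 : 0 < m - n → g (0, 0) = 1)

omit [NeZero m] in
include hgb in
/-- `φ` is a left inverse of the block renaming. [folklore] -/
theorem paddedPerPoly_aeval_subst_rename (Q : MvPolynomial (BlockIdx n m × BlockIdx n m) ℂ) :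
    aeval g (rename
      (fun ij : BlockIdx n m × BlockIdx n m => ((ij.1 : Fin m), (ij.2 : Fin m))) Q) = Q := by
  rw [aeval_rename]
  have hcomp : (g ∘ fun ij : BlockIdx n m × BlockIdx n m => ((ij.1 : Fin m), (ij.2 : Fin m))) =
      X := funext fun b => hgb b
  rw [hcomp, aeval_X_left_apply]

include hg0 in
/-- `φ` sends the padding factor `ℓ ^ p` to `1`. [folklore] -/
theorem paddedPerPoly_aeval_subst_X_zero_pow :
    aeval g ((X (0, 0) : MvPolynomial (Fin m × Fin m) ℂ) ^ (m - n)) = 1 := by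
  rcases Nat.eq_zero_or_pos (m - n) with h0 | hp
  · rw [h0, pow_zero, map_one]
  · rw [map_pow, aeval_X, hg0 hp, one_pow]

include hgb hg0 in
/-- `φ (pp) = per_B`. [folklore] -/
theorem aeval_subst_paddedPerPoly :
    aeval g (paddedPerPoly ℂ n m) = perPoly (BlockIdx n m) ℂ := by
  rw [paddedPerPoly, map_mul, paddedPerPoly_aeval_subst_X_zero_pow hg0, one_mul,
    paddedPerPoly_aeval_subst_rename hgb]

include hgb hg0 in
/-- `φ (∂_{ι a} pp) = ∂_a per_B`. [folklore] -/
theorem aeval_subst_pderiv_paddedPerPoly_block (a : BlockIdx n m × BlockIdx n m) :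
    aeval g (pderiv ((a.1 : Fin m), (a.2 : Fin m)) (paddedPerPoly ℂ n m)) =
      pderiv a (perPoly (BlockIdx n m) ℂ) := by
  rw [pderiv_paddedPerPoly_block, map_mul, paddedPerPoly_aeval_subst_X_zero_pow hg0, one_mul,
    paddedPerPoly_aeval_subst_rename hgb]

include hgb hg0 in
/-- `φ (∂_ℓ pp) = p · per_B` (`p ≥ 1`). [folklore] -/
theorem aeval_subst_pderiv_paddedPerPoly_zero (hp : 0 < m - n) :
    aeval g (pderiv (0, 0) (paddedPerPoly ℂ n m)) =
      ((m - n : ℕ) : ℂ) • perPoly (BlockIdx n m) ℂ := by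
  rw [pderiv_paddedPerPoly_zero n m hp, map_smul, map_mul, map_pow, aeval_X, hg0 hp,
    one_pow, one_mul, paddedPerPoly_aeval_subst_rename hgb]

/-! ## A Lie relation `∑_{a,b} N_{ba} X_b ∂_a pp = c · pp` after the substitution `φ` -/

include hgb hg0 in
/-- `φ` applied to the Lie relation. [folklore] -/
theorem paddedPerPoly_lieRel_subst (N : Matrix (Fin m × Fin m) (Fin m × Fin m) ℂ) (c : ℂ)
    (hN : ∑ a, ∑ b, N b a • (X b * pderiv a (paddedPerPoly ℂ n m)) =
      c • paddedPerPoly ℂ n m) :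
    ∑ a, ∑ b, N b a • (g b * aeval g (pderiv a (paddedPerPoly ℂ n m))) =
      c • perPoly (BlockIdx n m) ℂ := by
  have h := congr_arg (aeval g) hN
  simp only [map_sum, map_smul, map_mul, aeval_X] at h
  rwa [aeval_subst_paddedPerPoly hgb hg0] at h

include hgb hg0 in
/-- The relation after `φ`, case `p = 0` (the block is everything): it is the same relation for
`per_B`, with the matrix restricted along the block embedding. [folklore] -/
theorem paddedPerPoly_lieRel_subst_zero (hp : m - n = 0)
    (N : Matrix (Fin m × Fin m) (Fin m × Fin m) ℂ) (c : ℂ)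
    (hN : ∑ a, ∑ b, N b a • (X b * pderiv a (paddedPerPoly ℂ n m)) =
      c • paddedPerPoly ℂ n m) :
    ∑ a : BlockIdx n m × BlockIdx n m, ∑ b : BlockIdx n m × BlockIdx n m,
        N ((b.1 : Fin m), (b.2 : Fin m)) ((a.1 : Fin m), (a.2 : Fin m)) •
          (X b * pderiv a (perPoly (BlockIdx n m) ℂ)) = c • perPoly (BlockIdx n m) ℂ := by
  have hall : ∀ z : Fin m × Fin m, m - n ≤ (z.1 : ℕ) ∧ m - n ≤ (z.2 : ℕ) := fun z => by
    rw [hp]; exact ⟨Nat.zero_le _, Nat.zero_le _⟩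
  have h := paddedPerPoly_lieRel_subst hgb hg0 N c hN
  rw [paddedPerPoly_sum_special n m _ (fun z hz _ => absurd (hall z) hz), if_pos hp,
    zero_add] at h
  rw [← h]
  refine Finset.sum_congr rfl fun a _ => ?_
  rw [paddedPerPoly_sum_special n m _ (fun z hz _ => absurd (hall z) hz), if_pos hp, zero_add]
  refine Finset.sum_congr rfl fun b _ => ?_
  rw [hgb, aeval_subst_pderiv_paddedPerPoly_block hgb hg0]

include hgb hg0 in
/-- The relation after `φ`, case `p ≥ 1`, sorted as
`(degree n) + (degree n - 1) + (degree n + 1)`: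
`(∑_{a,b ∈ B×B} N_{ιb,ιa} X_b ∂_a per_B + N_{ℓℓ} p · per_B)`
`+ ∑_a N_{ℓ,ιa} ∂_a per_B + ∑_b N_{ιb,ℓ} X_b · p · per_B = c · per_B`. [folklore] -/
theorem paddedPerPoly_lieRel_subst_pos (hp : 0 < m - n)
    (hgz : ∀ z : Fin m × Fin m,
      ¬ (m - n ≤ (z.1 : ℕ) ∧ m - n ≤ (z.2 : ℕ)) → z ≠ (0, 0) → g z = 0)
    (N : Matrix (Fin m × Fin m) (Fin m × Fin m) ℂ) (c : ℂ)
    (hN : ∑ a, ∑ b, N b a • (X b * pderiv a (paddedPerPoly ℂ n m)) =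
      c • paddedPerPoly ℂ n m) :
    (∑ a : BlockIdx n m × BlockIdx n m, ∑ b : BlockIdx n m × BlockIdx n m,
        N ((b.1 : Fin m), (b.2 : Fin m)) ((a.1 : Fin m), (a.2 : Fin m)) •
          (X b * pderiv a (perPoly (BlockIdx n m) ℂ)) +
      (N (0, 0) (0, 0) * ((m - n : ℕ) : ℂ)) • perPoly (BlockIdx n m) ℂ) +
    (∑ a : BlockIdx n m × BlockIdx n m,
        N (0, 0) ((a.1 : Fin m), (a.2 : Fin m)) • pderiv a (perPoly (BlockIdx n m) ℂ)) +
    (∑ b : BlockIdx n m × BlockIdx n m, N ((b.1 : Fin m), (b.2 : Fin m)) (0, 0) •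
        (X b * (((m - n : ℕ) : ℂ) • perPoly (BlockIdx n m) ℂ))) =
      c • perPoly (BlockIdx n m) ℂ := by
  have hrow : ∀ a : Fin m × Fin m,
      ∑ b, N b a • (g b * aeval g (pderiv a (paddedPerPoly ℂ n m))) =
      N (0, 0) a • aeval g (pderiv a (paddedPerPoly ℂ n m)) +
        ∑ b : BlockIdx n m × BlockIdx n m, N ((b.1 : Fin m), (b.2 : Fin m)) a •
          (X b * aeval g (pderiv a (paddedPerPoly ℂ n m))) := by
    intro a
    rw [paddedPerPoly_sum_special n m _ (fun z hz hz0 => by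
      rw [hgz z hz hz0, zero_mul, smul_zero]), if_neg hp.ne', hg0 hp, one_mul]
    simp only [hgb]
  have h := paddedPerPoly_lieRel_subst hgb hg0 N c hN
  rw [paddedPerPoly_sum_special n m _ (fun z hz hz0 => by
    simp [pderiv_paddedPerPoly_nonspecial n m hz hz0]), if_neg hp.ne'] at h
  simp only [hrow] at h
  simp only [aeval_subst_pderiv_paddedPerPoly_zero hgb hg0 hp,
    aeval_subst_pderiv_paddedPerPoly_block hgb hg0, Finset.sum_add_distrib, smul_smul] at h
  rw [← h]
  abel

include hgb hg0 in
/-- **Rows off the block.** For a variable `z` off the block and `≠ ℓ` (`p ≥ 1`): applying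
`∂_z` to the relation kills `c · pp` and the second-order terms (`pp` is `z`-free), and then
`φ` gives `N_{zℓ} · p · per_B + ∑_a N_{z,ιa} ∂_a per_B = 0`. [folklore] -/
theorem paddedPerPoly_lieRel_row (hp : 0 < m - n)
    (N : Matrix (Fin m × Fin m) (Fin m × Fin m) ℂ) (c : ℂ)
    (hN : ∑ a, ∑ b, N b a • (X b * pderiv a (paddedPerPoly ℂ n m)) =
      c • paddedPerPoly ℂ n m)
    {z : Fin m × Fin m} (hz : ¬ (m - n ≤ (z.1 : ℕ) ∧ m - n ≤ (z.2 : ℕ)))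
    (hz0 : z ≠ (0, 0)) :
    N z (0, 0) • (((m - n : ℕ) : ℂ) • perPoly (BlockIdx n m) ℂ) +
      ∑ a : BlockIdx n m × BlockIdx n m,
        N z ((a.1 : Fin m), (a.2 : Fin m)) • pderiv a (perPoly (BlockIdx n m) ℂ) = 0 := by
  have hzpp := pderiv_paddedPerPoly_nonspecial n m hz hz0
  -- partial derivatives commute, so all `∂_z ∂_a pp` vanish
  have hcomm : ∀ (a : Fin m × Fin m) (f : MvPolynomial (Fin m × Fin m) ℂ),
      pderiv z (pderiv a f) = pderiv a (pderiv z f) := by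
    intro a f
    rcases eq_or_ne z a with rfl | hza
    · rfl
    ext d
    simp only [coeff_pderiv, Finsupp.coe_add, Pi.add_apply, Finsupp.single_apply, if_neg hza,
      if_neg hza.symm, add_zero, add_right_comm d (Finsupp.single z 1) (Finsupp.single a 1)]
    ring
  have h := congr_arg (pderiv z) hN
  rw [Derivation.map_smul, hzpp, smul_zero, map_sum] at h
  simp only [map_sum, Derivation.map_smul, pderiv_mul, hcomm, hzpp, map_zero,
    mul_zero, add_zero, pderiv_X, Pi.single_apply, ite_mul, one_mul, zero_mul, smul_ite,
    smul_zero, Finset.sum_ite_eq', Finset.mem_univ, if_true] at h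
  -- `h : ∑ a, N z a • ∂_a pp = 0`; apply `φ`
  have h2 := congr_arg (aeval g) h
  rw [map_sum, map_zero, paddedPerPoly_sum_special n m _ (fun z' hz' hz0' => by
    rw [map_smul, pderiv_paddedPerPoly_nonspecial n m hz' hz0', map_zero, smul_zero]),
    if_neg hp.ne'] at h2
  simpa only [map_smul, aeval_subst_pderiv_paddedPerPoly_zero hgb hg0 hp,
    aeval_subst_pderiv_paddedPerPoly_block hgb hg0] using h2

end Subst

end Literature.Computability.AlgebraicComplexity
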